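/-
Copyright (c) 2026. Released under the Apache 2.0 license.
-/
import Literature.NumberTheory.DiophantineGeometry.LocalReduction
import Mathlib.NumberTheory.NumberField.Basic
import Mathlib.RingTheory.RamificationInertia.Basic
import HarnessLib

/-!
# The semistability defect of an elliptic curve over `ℚ` at a prime `p` (Kraus 1990), INCLUDING
# `p = 2, 3` — a DEFINITION (with body) and its elementary API; no theorem of Kraus is asserted

Topic `Literature/NumberTheory/EllipticCurves`. Typed by the typer seat of the frontier cell
`bsd-f2-manin` (D-0131 (3); search question: «which LOCAL INVARIANT at `2` / `3` controls
`ord_p(c_E)` for additive reduction?», HOME `run/shared/lean/pub/bsd-f2-manin/`, CANDIDATES.md §B)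
to close the vocabulary gap recorded in `Serre1972/PotentiallyGoodInertiaOrder.lean` ("What is NOT
here: the cases `ℓ = 2, 3` (non-cyclic `Φ`)") and in
`Summits/BirchSwinnertonDyer/Rank1Residual/Additive/SharpenedStatements.lean` (`semistabilityIndex
:= 12 / gcd(12, v_p Δ)`, "junk … at a … wild `p`"): at `p ≥ 5` the order of the inertia image of a
potentially good curve is `12 / gcd(12, v_p(Δ_min))` (Serre 1972 §5.6), but at `p = 3` it takes the
values `2, 3, 4, 6, 12` and at `p = 2` the values `2, 3, 4, 6, 8, 24` (Kraus 1990; Coppola 2020 §2),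
and NO declaration of the tree names this number. Candidate laws of the cell that condition on it
(«`ord_2(c_E) = 0` when the defect at `2` is prime to `2`», …) are typed over THIS definition.

## The printed notion

A. Kraus, *Sur le défaut de semi-stabilité des courbes elliptiques à réduction additive*,
Manuscripta Math. 69 (1990) 353–385 [Kraus1990] (title notion; primary text not held by the hub),
as restated VERBATIM in the refereed secondary source N. Coppola, *Wild Galois representations:
elliptic curves over a 3-adic field*, Acta Arith. 195 (2020) 289–303 [Coppola2020], §2 (held text
`paper:arxiv-1812.05651`, p0005 L67–L91, p0006 L1–L30):

> "Suppose `E` has potentially good reduction (recall this is equivalent to the `j`-invariant of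
> `E` being integral) and let `L` be the minimal finite extension of `K^{nr}` over which `E`
> acquires good reduction. Then … for `ℓ ≠ p` the Galois representation `ρ_{E,ℓ}` factors through
> the quotient `I_K/I_L`, which is isomorphic to `Gal(L/K^{nr})` … since we chose `L` to be minimal,
> it injects into `Aut(T_ℓ(E))` … the image of inertia does not depend on `ℓ`, and we can restrict
> the set of possible inertia groups to `C₂, C₃, C₄, C₆`, `C₃ ⋊ C₄` only when `p = 3`, `Q₈`,
> `SL₂(𝔽₃)` only when `p = 2` … Since these groups have all different orders, if we know the degree
> of the extension `L/K^{nr}`, we can uniquely determine the Galois group of this extension"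

and (op. cit. Thm. 2.7 = Kraus's classification at `p = 3`, quoted for orientation only, NOT
transcribed as a fact here): "if `E` has type `I₀*`, then `v(Δ) = 6` and `Gal_L ≅ C₂`; if `E` has type
`III`, then `v(Δ) = 3` and `Gal_L ≅ C₄`; if `E` has type `III*`, then `v(Δ) = 9` and `Gal_L ≅ C₄`; if
`v(Δ) ≡ 0 (mod 4)`, then `Gal_L ≅ C₃`; if `v(Δ) ≡ 2 (mod 4)` and `E` has type different from `I₀*`,
then `Gal_L ≅ C₆`; if `v(Δ)` is odd and `E` has type different from `III` and `III*`, then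
`Gal_L ≅ C₃ ⋊ C₄`." (So at `p = 3` the defect is a function of the tree's `kodairaSymbolAt` and
`ordMinimalDiscriminant`; at `p = 2` Kraus's classification uses `v₂(c₄), v₂(c₆), v₂(Δ)` and
congruences — [Kraus1990], not restated by Coppola.)

## The rendering (GLOBAL, in the vocabulary of `LocalReduction.lean` and of
## `Summits/…/Additive/PotGoodOrdinary.lean`'s `TypeG`)

For `W : WeierstrassCurve ℚ` and a prime `p`, a **semistability witness of index `e`** is a number
field `F`, a finite place `w` of `F` above `p` (`(p : 𝓞 F) ∈ w.asIdeal`) with ramification index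
`e(w | p) = e` (Mathlib `w.asIdeal.ramificationIdx ℤ`), such that the base change `W_F` is
SEMISTABLE at `w` (`WeierstrassCurve.IsSemistableAt`: good or multiplicative reduction of the
`w`-adic minimal model). The **semistability defect** `W.semistabilityDefectAt p` is the LEAST such
`e` (`sInf`, junk value `0` iff there is no witness). Why this is the printed number: semistable
reduction at `w` depends only on `W` over the completion `F_w`, every finite extension of `ℚ_p`
is a completion of a number field (Krasner), and for a potentially good `E/ℚ_p` a finite `K'/ℚ_p`
has `E_{K'}` of good reduction iff `K'·ℚ_p^{nr} ⊇ L` (Néron–Ogg–Shafarevich), the minimum of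
`e(K'/ℚ_p) = [K'ℚ_p^{nr} : ℚ_p^{nr}]` being attained (`Gal(L/ℚ_p)` is an extension of `Ẑ` by the
finite group `Gal(L/ℚ_p^{nr})`, and `Ẑ` is projective) — so the defect equals `[L : ℚ_p^{nr}] = |Φ_p|`
for potentially good reduction; it is `1` iff `W` is semistable at `p`, and `2` for additive
potentially multiplicative reduction (a ramified quadratic twist of a Tate curve). None of these
identifications is proved here; they are the reading of the definition, and consumers who need
one take it as an explicit hypothesis or prove it.

## What is here / NOT here

* `WeierstrassCurve.IsSemistabilityWitnessAt W p e` (predicate, body as above),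
  `WeierstrassCurve.semistabilityDefectAt W p : ℕ` (the `sInf`).
* PROVED API: `semistabilityDefectAt_le` (a witness of index `e` bounds the defect by `e`),
  `isSemistabilityWitnessAt_semistabilityDefectAt` (if some witness exists, the defect is attained),
  `IsSemistabilityWitnessAt.pos` (every witness has `e ≥ 1`: ramification indices of primes of a
  ring of integers over `ℤ` are positive), `semistabilityDefectAt_eq_zero_iff` (the junk value `0`
  occurs iff there is no witness), `semistabilityDefectAt_pos_iff`.
* NOT here (deliberately): the semistable reduction theorem (existence of a witness for every
  elliptic `W`, Silverman AEC VII.5.4 — a separate published theorem, not needed to STATE laws);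
  Kraus's classifications at `p = 2, 3` and Serre's `12 / gcd(12, v_p Δ)` at `p ≥ 5` (theorems in
  print; to be vendored as named facts only when a consumer needs them, D-0026); any link to Manin
  constants (the cell's candidate laws live under `Summits/BirchSwinnertonDyer/Rank1Residual/`).
  No instance, no notation, no `sorry`, no new named fact.

## References
* [Kraus1990] A. Kraus, *Sur le défaut de semi-stabilité des courbes elliptiques à réduction
  additive*, Manuscripta Math. 69 (1990), 353–385.
* [Coppola2020] N. Coppola, *Wild Galois representations: elliptic curves over a 3-adic field*,
  Acta Arith. 195 (2020), no. 3, 289–303, §2 (definition of `L`, list of inertia groups),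
  Lemma 2.6, Thm. 2.7.
* [Serre1972] J.-P. Serre, *Propriétés galoisiennes des points d'ordre fini des courbes
  elliptiques*, Invent. Math. 15 (1972), §5.6 (the case `p ≥ 5`; tree:
  `Literature.NumberTheory.EllipticCurves.Serre1972.inertiaOrder_dvd_card_range_galoisRepTorsion`).
* J.-P. Serre, J. Tate, *Good reduction of abelian varieties*, Ann. of Math. 88 (1968), §2
  (`Φ_p ↪ Aut(Ẽ_L)`); J. H. Silverman, *AEC*, VII.5.4 (semistable reduction theorem).
-/

noncomputable section

open scoped NumberField

open IsDedekindDomain NumberField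

namespace WeierstrassCurve

variable (W : WeierstrassCurve ℚ) (p : ℕ)

/-- **Semistability witness of index `e` at `p`** for `W/ℚ`: a number field `F` and a finite place
`w` of `F` above `p` with ramification index `e(w | p) = e` such that `W_F` has semistable (good or
multiplicative) reduction at `w`. The global spelling of "`E` acquires semistable reduction over a
finite extension `K'/ℚ_p` of ramification index `e`" (module docstring; Kraus 1990 via Coppola 2020
§2: "let `L` be the minimal finite extension of `K^{nr}` over which `E` acquires good reduction").
A predicate with a body; nothing asserted. (Deliberate dot-notation extension of the Mathlib
namespace `WeierstrassCurve`, as in `LocalReduction.lean`.)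
[cite: Coppola2020, §2 (Acta Arith. 195 (2020) 289–303; arXiv:1812.05651 §2, paragraph before Lemma 2.6: definition of L and of the inertia image)] -/
def IsSemistabilityWitnessAt (e : ℕ) : Prop :=
  ∃ (F : Type) (_ : Field F) (_ : NumberField F) (w : HeightOneSpectrum (𝓞 F)),
    (p : 𝓞 F) ∈ w.asIdeal ∧ w.asIdeal.ramificationIdx ℤ = e ∧ (W.baseChange F).IsSemistableAt w

/-- **The semistability defect of `W/ℚ` at `p`** (Kraus 1990, "défaut de semi-stabilité"; Coppola
2020 §2: the degree `[L : K^{nr}]` of the minimal extension of `ℚ_p^{nr}` over which `E` acquires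
good reduction `=` the order of the inertia image `Φ_p ⊆ Aut(T_ℓ E)`, `ℓ ≠ p`, in the potentially
good case): the least ramification index `e(w | p)` of a semistability witness
(`IsSemistabilityWitnessAt`). Values (reading, not proved here): `1` iff semistable at `p`; `2` for
additive potentially multiplicative reduction; for potentially good reduction `12/gcd(12, v_p Δ)` at
`p ≥ 5` (Serre), `∈ {2,3,4,6,12}` at `p = 3` and `∈ {2,3,4,6,8,24}` at `p = 2` (Kraus). JUNK VALUE:
`0` iff there is no witness (`semistabilityDefectAt_eq_zero_iff`); by the semistable reduction
theorem this never happens for an elliptic `W` (not proved here), and the value is junk for a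
singular `W`. (Deliberate dot-notation extension of the Mathlib namespace `WeierstrassCurve`.)
[cite: Kraus1990, title notion and §1 (Manuscripta Math. 69 (1990) 353–385), as restated in Coppola2020 §2] -/
def semistabilityDefectAt : ℕ :=
  sInf {e : ℕ | W.IsSemistabilityWitnessAt p e}

variable {W p}

/-- Unfolding: the defect is the infimum of the witness indices (the printed "minimal finite
extension of `K^{nr}` over which `E` acquires good reduction", read through ramification indices).
[cite: Coppola2020, §2 (definition of L, paragraph before Lemma 2.6; arXiv:1812.05651)] -/
theorem semistabilityDefectAt_def :
    W.semistabilityDefectAt p = sInf {e : ℕ | W.IsSemistabilityWitnessAt p e} := rfl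

/-- A semistability witness of index `e` bounds the defect: `W.semistabilityDefectAt p ≤ e`
(in print: `L` is the MINIMAL extension of `K^{nr}` over which `E` acquires good reduction, so every
field of good reduction contains `L` and `|Φ_p| = [L : K^{nr}] ≤ e(K'/ℚ_p)`; here by `Nat.sInf_le`).
[cite: Coppola2020, §2 (minimality of L, paragraph before Lemma 2.6)] -/
theorem semistabilityDefectAt_le {e : ℕ} (h : W.IsSemistabilityWitnessAt p e) :
    W.semistabilityDefectAt p ≤ e :=
  Nat.sInf_le h

/-- If some semistability witness exists at `p`, the defect is attained by a witness (in print: the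
minimal extension `L` exists; here `Nat.sInf_mem`). [cite: Coppola2020, §2 (existence of L, paragraph before Lemma 2.6)] -/
theorem isSemistabilityWitnessAt_semistabilityDefectAt (h : ∃ e, W.IsSemistabilityWitnessAt p e) :
    W.IsSemistabilityWitnessAt p (W.semistabilityDefectAt p) :=
  Nat.sInf_mem h

/-- Every witness has positive index: the ramification index over `ℤ` of a nonzero prime of the ring
of integers of a number field is positive (Mathlib `Ideal.ramificationIdx_pos`; Neukirch, ANT I §8,
`e_i ≥ 1` in the fundamental identity). [cite: NeukirchANT1999, Ch. I §8 Prop. 8.2 (e_i ≥ 1)] -/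
theorem IsSemistabilityWitnessAt.pos {e : ℕ} (h : W.IsSemistabilityWitnessAt p e) : 0 < e := by
  obtain ⟨F, _, _, w, -, he, -⟩ := h
  rw [← he]
  haveI : w.asIdeal.IsPrime := w.isPrime
  exact Ideal.ramificationIdx_pos w.asIdeal ℤ

/-- `0` is never a witness index (ramification indices are `≥ 1`).
[cite: NeukirchANT1999, Ch. I §8 Prop. 8.2 (e_i ≥ 1)] -/
theorem not_isSemistabilityWitnessAt_zero : ¬ W.IsSemistabilityWitnessAt p 0 :=
  fun h ↦ (lt_irrefl 0) h.pos

/-- The junk value: the defect is `0` iff there is NO semistability witness at `p` (for an elliptic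
`W` a witness always exists by the semistable reduction theorem, Silverman AEC VII.5.4 — not proved
here; this lemma only characterises the `sInf ∅ = 0` convention against the positivity of
ramification indices). [cite: SilvermanAEC2009, Prop. VII.5.4 (semistable reduction theorem; context of the junk value)] -/
theorem semistabilityDefectAt_eq_zero_iff :
    W.semistabilityDefectAt p = 0 ↔ ∀ e, ¬ W.IsSemistabilityWitnessAt p e := by
  rw [semistabilityDefectAt_def, Nat.sInf_eq_zero]
  constructor
  · rintro (h0 | hempty)
    · exact absurd h0 not_isSemistabilityWitnessAt_zero
    · intro e he
      have : e ∈ ({e : ℕ | W.IsSemistabilityWitnessAt p e} : Set ℕ) := he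
      rw [hempty] at this
      exact this
  · intro h
    exact Or.inr (Set.eq_empty_iff_forall_notMem.mpr fun e he ↦ h e he)

/-- The defect is positive iff some semistability witness exists (the contrapositive reading of
the junk-value lemma; for elliptic `W` the right side is the semistable reduction theorem).
[cite: SilvermanAEC2009, Prop. VII.5.4 (semistable reduction theorem)] -/
theorem semistabilityDefectAt_pos_iff :
    0 < W.semistabilityDefectAt p ↔ ∃ e, W.IsSemistabilityWitnessAt p e := by
  rw [pos_iff_ne_zero, ne_eq, semistabilityDefectAt_eq_zero_iff]
  push Not
  rfl

/-- A witness of index `e` gives `0 < defect` (with `semistabilityDefectAt_le`: `0 < defect ≤ e`).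
[cite: Coppola2020, §2 (L exists and is minimal, paragraph before Lemma 2.6)] -/
theorem semistabilityDefectAt_pos_of_witness {e : ℕ} (h : W.IsSemistabilityWitnessAt p e) :
    0 < W.semistabilityDefectAt p :=
  semistabilityDefectAt_pos_iff.mpr ⟨e, h⟩

end WeierstrassCurve

end
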